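import Literature.Probability.Percolation.SlabRSWGluingOrient
import HarnessLib

/-!
# Newman–Tassion–Wu 2017, §3.3 — interleaved crossings on one side of a rectangle

Topic: `Literature/Probability/Percolation`. The planar-crossing hypothesis of NTW's gluing lemma
GL0 (Thm. 3.6: "the projection on ℤ² of any path from Ā to B̄ in S̄ intersects the projection of
any path from C̄ to D̄ in S̄") in the configuration of Theorem 3.14, Case 1: `A, B, C, D` are four
segments `Z_j` of ONE side of the rectangle, interleaved (`A` below `C` below `B` below `D`). The
discrete Jordan-type fact is reduced to the tree's `exists_mem_support_of_crossing` (a left-right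
and a bottom-top crossing of a rectangle meet) by extending both walks outside the rectangle into
crossings of `[L, R+2] × [B-1, T+2]` along two further columns.

* `exists_mem_support_of_interleaved` — lattice walks of `ℤ²` inside `[L,R] × [B,T]`, `P` from
  `a₁` to `a₂` and `Q` from `c₁` to `c₂`, all four on the right side with
  `a₁ < c₁ < a₂ < c₂` (second coordinates): `P` and `Q` share a vertex.
* `planarCrossing_interleaved` — the `PlanarCrossing` hypothesis for `S = [a,b] × [c,d]` and four
  subsets `A, C, B, D` of the right side lying in successive disjoint height ranges.
* `glueLinear_seg_interleaved` — **GL0, linear regime, for four interleaved segments of the right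
  side** (the gluing step of Theorem 3.14, Case 1).

## Sources

* C. M. Newman, V. Tassion, W. Wu, *Critical percolation and the minimal spanning tree in slabs*,
  Comm. Pure Appl. Math. 70 (2017), arXiv:1512.09107: §3.2 (Theorem 3.6, hypothesis), §3.3
  (proof of Theorem 3.14, Case 1: "(GL0) in R with A = Z₃, B = Z_{i-1}, C = Z_{i-2}, D = Z_i")
  [NewmanTassionWu2017].
-/

noncomputable section

namespace Literature.Probability.Percolation

open MeasureTheory LatticeModels SimpleGraph

namespace NTW17

variable {k : ℕ}

/-! ## The lattice-walk statement -/

/-- **Interleaved endpoints on one side force a crossing.** Let `P` be a lattice walk of `ℤ²`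
inside `[L,R] × [B,T]` from `a₁` to `a₂` and `Q` one from `c₁` to `c₂`, all four endpoints on the
right side `{x = R}` with `a₁ < c₁ < a₂ < c₂` (heights). Then `P` and `Q` have a common vertex.
(Reduction to `exists_mem_support_of_crossing`: extend `P` below `a₁` along the column `R+1` and
above `a₂` along the column `R+2`, and `Q` above `c₂` along the column `R+1` then along the row
`T+2` to the left side, and right of `c₁` to the column `R+2`; the extensions are pairwise
disjoint and outside the rectangle.) [cite: NewmanTassionWu2017, §3.3 (proof of Theorem 3.14, Case 1, hypothesis of GL0)] -/
theorem exists_mem_support_of_interleaved {L R B T : ℤ} {a₁ a₂ c₁ c₂ : Site 2}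
    (P : (zdGraph 2).Walk a₁ a₂) (Q : (zdGraph 2).Walk c₁ c₂)
    (hP : ∀ z ∈ P.support, L ≤ z 0 ∧ z 0 ≤ R ∧ B ≤ z 1 ∧ z 1 ≤ T)
    (hQ : ∀ z ∈ Q.support, L ≤ z 0 ∧ z 0 ≤ R ∧ B ≤ z 1 ∧ z 1 ≤ T)
    (ha₁ : a₁ 0 = R) (ha₂ : a₂ 0 = R) (hc₁ : c₁ 0 = R) (hc₂ : c₂ 0 = R)
    (h1 : a₁ 1 < c₁ 1) (h2 : c₁ 1 < a₂ 1) (h3 : a₂ 1 < c₂ 1) :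
    ∃ z ∈ P.support, z ∈ Q.support := by
  have ha₁b := hP a₁ P.start_mem_support
  have ha₂b := hP a₂ P.end_mem_support
  have hc₁b := hQ c₁ Q.start_mem_support
  have hc₂b := hQ c₂ Q.end_mem_support
  -- the auxiliary points
  set u₀ : Site 2 := ts (R + 1, B - 1) with hu₀
  set u₁ : Site 2 := ts (R + 1, a₁ 1) with hu₁
  set u₂ : Site 2 := ts (R + 1, a₂ 1) with hu₂
  set u₃ : Site 2 := ts (R + 2, a₂ 1) with hu₃
  set u₄ : Site 2 := ts (R + 2, T + 2) with hu₄
  set v₀ : Site 2 := ts (L, T + 2) with hv₀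
  set v₁ : Site 2 := ts (R + 1, T + 2) with hv₁
  set v₂ : Site 2 := ts (R + 1, c₂ 1) with hv₂
  set v₃ : Site 2 := ts (R + 1, c₁ 1) with hv₃
  set v₄ : Site 2 := ts (R + 2, c₁ 1) with hv₄
  -- the extension of `P` to a bottom-top crossing of `[L, R+2] × [B-1, T+2]`
  obtain ⟨W1, hW1⟩ := exists_walk_vertical (z := u₀) (w := u₁) (by simp [hu₀, hu₁]) (by simp [hu₀, hu₁]; omega)
  have s1 : (zdGraph 2).Adj u₁ a₁ := adj_of_stepKind (.left (by simp [hu₁, ha₁]) (by simp [hu₁]))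
  have s2 : (zdGraph 2).Adj a₂ u₂ := adj_of_stepKind (.right (by simp [hu₂, ha₂]) (by simp [hu₂]))
  have s3 : (zdGraph 2).Adj u₂ u₃ := adj_of_stepKind (.right (by simp [hu₂, hu₃]; ring) (by simp [hu₂, hu₃]))
  obtain ⟨W2, hW2⟩ := exists_walk_vertical (z := u₃) (w := u₄) (by simp [hu₃, hu₄]) (by simp [hu₃, hu₄]; omega)
  let P' : (zdGraph 2).Walk u₀ u₄ :=
    W1.append (Walk.cons s1 (P.append (Walk.cons s2 (Walk.cons s3 W2))))
  -- the extension of `Q` (reversed) to a left-right crossing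
  obtain ⟨H1, hH1⟩ := exists_walk_horizontal (z := v₀) (w := v₁) (by simp [hv₀, hv₁]) (by simp [hv₀, hv₁]; omega)
  obtain ⟨V1, hV1⟩ := exists_walk_vertical (z := v₂) (w := v₁) (by simp [hv₂, hv₁]) (by simp [hv₂, hv₁]; omega)
  have t1 : (zdGraph 2).Adj v₂ c₂ := adj_of_stepKind (.left (by simp [hv₂, hc₂]) (by simp [hv₂]))
  have t2 : (zdGraph 2).Adj c₁ v₃ := adj_of_stepKind (.right (by simp [hv₃, hc₁]) (by simp [hv₃]))
  have t3 : (zdGraph 2).Adj v₃ v₄ := adj_of_stepKind (.right (by simp [hv₃, hv₄]; ring) (by simp [hv₃, hv₄]))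
  let Q' : (zdGraph 2).Walk v₀ v₄ :=
    H1.append (V1.reverse.append (Walk.cons t1 (Q.reverse.append (Walk.cons t2 (Walk.cons t3 Walk.nil)))))
  -- supports
  have hP'sup : ∀ z ∈ P'.support, z ∈ P.support ∨
      ((z 0 = R + 1 ∧ z 1 ≤ a₁ 1 ∧ B - 1 ≤ z 1) ∨ (z 0 = R + 1 ∧ z 1 = a₂ 1) ∨
        (z 0 = R + 2 ∧ a₂ 1 ≤ z 1 ∧ z 1 ≤ T + 2)) := by
    intro z hz
    simp only [P', Walk.mem_support_append_iff, Walk.support_cons, List.mem_cons] at hz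
    rcases hz with hz | rfl | hz | rfl | rfl | hz
    · have := hW1 z hz; right; left; simp [hu₀, hu₁] at this; omega
    · right; left; simp [hu₁]; omega
    · exact Or.inl hz
    · exact Or.inl P.end_mem_support
    · right; right; left; simp [hu₂]
    · have := hW2 z hz; right; right; right; simp [hu₃, hu₄] at this; omega
  have hQ'sup : ∀ z ∈ Q'.support, z ∈ Q.support ∨
      ((z 1 = T + 2 ∧ L ≤ z 0 ∧ z 0 ≤ R + 1) ∨ (z 0 = R + 1 ∧ c₂ 1 ≤ z 1 ∧ z 1 ≤ T + 2) ∨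
        (z 0 = R + 1 ∧ z 1 = c₁ 1) ∨ (z 0 = R + 2 ∧ z 1 = c₁ 1)) := by
    intro z hz
    simp only [Q', Walk.mem_support_append_iff, Walk.support_cons, Walk.support_reverse,
      List.mem_reverse, List.mem_cons, Walk.support_nil, List.not_mem_nil, or_false] at hz
    rcases hz with hz | hz | rfl | hz | rfl | rfl | rfl
    · have := hH1 z hz; right; left; simp [hv₀, hv₁] at this; omega
    · have := hV1 z hz; right; right; left; simp [hv₂, hv₁] at this; omega
    · right; right; left; simp [hv₂]; omega
    · exact Or.inl hz
    · exact Or.inl Q.start_mem_support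
    · right; right; right; left; simp [hv₃]
    · right; right; right; right; simp [hv₄]
  have hP'box : ∀ z ∈ P'.support, L ≤ z 0 ∧ z 0 ≤ R + 2 ∧ B - 1 ≤ z 1 ∧ z 1 ≤ T + 2 := by
    intro z hz
    rcases hP'sup z hz with h | h
    · have := hP z h; omega
    · omega
  have hQ'box : ∀ z ∈ Q'.support, L ≤ z 0 ∧ z 0 ≤ R + 2 ∧ B - 1 ≤ z 1 ∧ z 1 ≤ T + 2 := by
    intro z hz
    rcases hQ'sup z hz with h | h
    · have := hQ z h; omega
    · omega
  obtain ⟨z, hzQ', hzP'⟩ := exists_mem_support_of_crossing Q' P' hQ'box hP'box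
    (by simp [hv₀]) (by simp [hv₄]) (by simp [hu₀]) (by simp [hu₄])
  rcases hP'sup z hzP' with hzP | hzP
  · rcases hQ'sup z hzQ' with hzQ | hzQ
    · exact ⟨z, hzP, hzQ⟩
    · have := hP z hzP; omega
  · rcases hQ'sup z hzQ' with hzQ | hzQ
    · have := hQ z hzQ; omega
    · omega

/-! ## The planar-crossing hypothesis for interleaved subsets of the right side -/

/-- **Interleaved subsets of the right side.** In `S = [a,b] × [c,d]`, if `A, C, B, D` are subsets
of the right side `{x = b}` with heights in `(-∞, t₁)`, `[t₁, t₂)`, `[t₂, t₃)`, `[t₃, ∞)`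
respectively, then every planar walk in `S` from `A` to `B` meets every
planar walk in `S` from `C` to `D`. [cite: NewmanTassionWu2017, §3.3 (proof of Theorem 3.14, Case 1, hypothesis of GL0)] -/
theorem planarCrossing_interleaved {a b c d t₁ t₂ t₃ : ℤ} {A B C D : Set (ℤ × ℤ)}
    (hA : ∀ z ∈ A, z.1 = b ∧ z.2 < t₁) (hC : ∀ z ∈ C, z.1 = b ∧ t₁ ≤ z.2 ∧ z.2 < t₂)
    (hB : ∀ z ∈ B, z.1 = b ∧ t₂ ≤ z.2 ∧ z.2 < t₃) (hD : ∀ z ∈ D, z.1 = b ∧ t₃ ≤ z.2) :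
    PlanarCrossing (boxR a b c d) A B C D := by
  intro l₁ l₂ h₁ h₂ hw₁ hw₂ hS₁ hS₂ hhA hlB hhC hlD
  obtain ⟨x₁, r₁, rfl⟩ := List.exists_cons_of_ne_nil h₁
  obtain ⟨x₂, r₂, rfl⟩ := List.exists_cons_of_ne_nil h₂
  obtain ⟨e₁, W₁, he₁, hW₁⟩ := exists_walk_of_planarWalk x₁ r₁ hw₁
  obtain ⟨e₂, W₂, he₂, hW₂⟩ := exists_walk_of_planarWalk x₂ r₂ hw₂
  have hbox : ∀ (l : List (ℤ × ℤ)), (∀ z ∈ l, z ∈ boxR a b c d) →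
      ∀ {u v : Site 2} (W : (zdGraph 2).Walk u v), (∀ x ∈ W.support, ∃ w ∈ l, ts w = x) →
      ∀ x ∈ W.support, a ≤ x 0 ∧ x 0 ≤ b ∧ c ≤ x 1 ∧ x 1 ≤ d := by
    intro l hl u v W hW x hx
    obtain ⟨w, hw, rfl⟩ := hW x hx
    have := hl w hw
    rw [mem_boxR_iff] at this
    simpa using this
  have he₁B : e₁ ∈ B := by rw [← he₁]; exact hlB
  have he₂D : e₂ ∈ D := by rw [← he₂]; exact hlD
  simp only [List.head_cons] at hhA hhC
  obtain ⟨hA1, hA2⟩ := hA x₁ hhA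
  obtain ⟨hB1, hB2, hB3⟩ := hB e₁ he₁B
  obtain ⟨hC1, hC2, hC3⟩ := hC x₂ hhC
  obtain ⟨hD1, hD2⟩ := hD e₂ he₂D
  obtain ⟨z, hz₁, hz₂⟩ := exists_mem_support_of_interleaved W₁ W₂ (hbox _ hS₁ W₁ hW₁)
    (hbox _ hS₂ W₂ hW₂) (by simpa using hA1) (by simpa using hB1) (by simpa using hC1)
    (by simpa using hD1) (by simp; omega) (by simp; omega) (by simp; omega)
  obtain ⟨v₁, hv₁, rfl⟩ := hW₁ z hz₁
  obtain ⟨v₂, hv₂, hv⟩ := hW₂ _ hz₂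
  exact ⟨v₁, hv₁, by rwa [← ts_injective hv]⟩

/-- **GL0, linear regime, for interleaved segments of the right side** (the gluing step of
Theorem 3.14, Case 1): in `S = [a,b] × [c,d]` of the slab `S_k` with `B = {b} × [y₁, y₂]`
(`y₁ < y₂`) and `A, C, D` subsets of the right side with heights below `t₁`, in `(t₁, y₁)`, and
above `y₂` respectively (`A, C ⊆ S`, heights of `C` in `[t₁, y₁)`, `dist*(A, C) > 4ρ + 8`, `ρ ≥ 4`): for `0 < p < 1`,
`P_p[A ⟷^S B] · P_p[C ⟷^S D] ≤ (1 + λ^s) · P_p[C ⟷^S A]`.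
[cite: NewmanTassionWu2017, §3.3 (proof of Theorem 3.14, Case 1), §3.2 (Theorem 3.6 with Remark 3)] -/
theorem glueLinear_seg_interleaved (V : SegSetup) (hk : 1 ≤ k) {ρ : ℕ} (hρ : 4 ≤ ρ)
    (hsep : ∀ a' ∈ V.A, ∀ c' ∈ V.C, c' ∉ sqBox a' (4 * ρ + 8)) {t₁ : ℤ} {Dd : Set (ℤ × ℤ)}
    (hAr : ∀ z ∈ V.A, z.1 = V.b ∧ z.2 < t₁) (hCr : ∀ z ∈ V.C, z.1 = V.b ∧ t₁ ≤ z.2 ∧ z.2 < V.y₁)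
    (hDr : ∀ z ∈ Dd, z.1 = V.b ∧ V.y₂ < z.2)
    (p : unitInterval) (hp0 : 0 < (p : ℝ)) (hp1 : (p : ℝ) < 1) :
    (bondPercolation (slabGraph 3 k) p).real (slabConn k V.S V.A V.B) *
        (bondPercolation (slabGraph 3 k) p).real (slabConn k V.S V.C Dd) ≤
      (1 + (2 / min (p : ℝ) (1 - p)) ^ (3 * ((5 * k + 4) * (2 * (2 * (3 * ρ + 3)) + 1) ^ 2))) *
        (bondPercolation (slabGraph 3 k) p).real (slabConn k V.S V.C V.A) :=
  glueLinear_seg V hk hρ hsep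
    (planarCrossing_interleaved (a := V.a) (b := V.b) (c := V.c) (d := V.d) (t₁ := t₁)
      (t₂ := V.y₁) (t₃ := V.y₂ + 1) hAr hCr
      (fun z hz => by rw [SegSetup.mem_B_iff] at hz; exact ⟨hz.1, hz.2.1, by omega⟩)
      (fun z hz => ⟨(hDr z hz).1, by have := (hDr z hz).2; omega⟩))
    p hp0 hp1

end NTW17

end Literature.Probability.Percolation
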